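import Summits.ValiantsHypothesis.ValiantsHypothesis.Theorems.BarrierLeverAnchoredDoorHitsLowerPairsLTCertificate

/-!
# Support item `AnchoredDoorHitsLowerPairs` (stmt-ValiantsHypothesis-22510), line `anchored-peeling`:
# A KERNEL-CHECKABLE LT-CERTIFICATE FORMAT — bitmask data, a Boolean decision procedure for door supports, and `LTCert` from `decide`-able hypotheses

Helper file (`--supports stmt-ValiantsHypothesis-22510`; cell valiant-natproofs, rung V4, 𝒟-side door (c); registered line
`Cruxes/AnchoredDoorHitsLowerPairs/Lines/anchored_peeling.lean` v18 (registered residual `Stmt.stub_relApexRest`; planner asks (A)/(B) of STATUS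
2026-08-28T15:24:35Z: the certificate route); prover seat val-np-p1 gen 22; memo HOME/val-np-p1/g22/MEMO-relapex-valnp1-g22.md §4–§7). Closes NO item.

WHY. LT certificates (`LTCert`, `det_doorLayout_ne_zero_of_ltCert` of `…LTCertificate`, p634984) are the line's tool of reach on the count-rigid members of the
residual (memo §4: e.g. `(R₃, K₇)` has NO relative typed apex split but HAS an LT certificate, found by SAT). `LTCert` quantifies over support functions and
permutations and `DoorSupp` over block families, so a concrete certificate cannot be fed to the kernel as stated. This file gives an equivalent COMPUTABLE
format: rows, columns, root sets and tail sets as BITMASKS (`ℕ`, read through `ofBits`), the support predicate decided by structural recursion over the column's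
vertex list with submask enumeration (`suppDec`; soundness `suppDec_iff` from `doorSupp_empty` / `doorSupp_insert`), and the certificate theorem
`ltCert_of_suppDec` whose hypotheses (`suppDec … = true` on the diagonal, `= false` below it, inverse permutation tables) are all closed by `decide` on literal data.
Every SAT-found certificate (kit j311123 / j311444, g21's `ltsat.py`) thereby becomes an `LTCert` instance, hence a profile-1 hit (`…LTRest`).

WHAT THIS IS NOT: bookkeeping only (no new mathematics); nothing on crux stmt-ValiantsHypothesis-14610 or on `VP` versus `VNP`.
-/

set_option linter.dupNamespace false

namespace Summit.ValiantsHypothesis.ValiantsHypothesis.Theorems.BarrierLever.AnchoredPeeling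

open Finset

section Bits

variable {h : ℕ}

/-! ## 1. Bitmasks as finsets of `Fin h` -/

/-- The finset of `Fin h` encoded by the bitmask `n` (bits `≥ h` are ignored). -/
def ofBits (h n : ℕ) : Finset (Fin h) := Finset.univ.filter (fun b => n.testBit b.val = true)

/-- Membership in `ofBits`. -/
theorem mem_ofBits {n : ℕ} {b : Fin h} : b ∈ ofBits h n ↔ n.testBit b.val = true := by
  simp [ofBits]

/-- A bitmask below `2^h` with no members is `0`. -/
theorem ofBits_eq_empty_iff {n : ℕ} (hn : n < 2 ^ h) : ofBits h n = ∅ ↔ n = 0 := by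
  constructor
  · intro he
    refine Nat.zero_of_testBit_eq_false (fun i => ?_)
    by_cases hi : i < h
    · by_contra hne
      have hmem : (⟨i, hi⟩ : Fin h) ∈ ofBits h n := mem_ofBits.mpr (by cases hb : n.testBit i <;> simp_all)
      rw [he] at hmem
      exact absurd hmem (Finset.notMem_empty _)
    · exact Nat.testBit_eq_false_of_lt (lt_of_lt_of_le hn (Nat.pow_le_pow_right (by norm_num) (not_lt.mp hi)))
  · rintro rfl
    ext b
    simp [mem_ofBits]

/-- The set bits of `n` below `h`, as a list of naturals. -/
def bitsList (h n : ℕ) : List ℕ := (List.range h).filter (fun b => n.testBit b)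

/-- Membership in `bitsList`. -/
theorem mem_bitsList {n b : ℕ} : b ∈ bitsList h n ↔ b < h ∧ n.testBit b = true := by
  simp [bitsList, List.mem_filter, List.mem_range]

/-- `bitsList` has no duplicates. -/
theorem bitsList_nodup (n : ℕ) : (bitsList h n).Nodup := (List.nodup_range).filter _

/-- The set bits of `n` below `h`, as a list of `Fin h`. -/
def bitsFinList (h n : ℕ) : List (Fin h) := (List.finRange h).filter (fun b => n.testBit b.val)

/-- `bitsFinList` has no duplicates. -/
theorem bitsFinList_nodup (n : ℕ) : (bitsFinList h n).Nodup := (List.nodup_finRange h).filter _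

/-- `bitsFinList` enumerates `ofBits`. -/
theorem toFinset_bitsFinList (n : ℕ) : (bitsFinList h n).toFinset = ofBits h n := by
  ext b
  simp [bitsFinList, ofBits]

/-! ## 2. Submask enumeration -/

/-- All bitmasks whose set bits lie in the list `l`. -/
def subOf : List ℕ → List ℕ
  | [] => [0]
  | b :: l => subOf l ++ (subOf l).map (fun Z => Z ||| 2 ^ b)

/-- Membership in `subOf l` for a duplicate-free list: exactly the bitmasks supported on `l`. -/
theorem mem_subOf {l : List ℕ} (hl : l.Nodup) {Z : ℕ} : Z ∈ subOf l ↔ ∀ i, Z.testBit i = true → i ∈ l := by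
  induction l generalizing Z with
  | nil =>
    simp only [subOf, List.mem_singleton, List.not_mem_nil, imp_false]
    constructor
    · rintro rfl i; simp
    · intro hZ
      exact Nat.zero_of_testBit_eq_false (fun i => by cases hb : Z.testBit i <;> simp_all)
  | cons b l ih =>
    have hbl : b ∉ l := (List.nodup_cons.mp hl).1
    have hl' : l.Nodup := (List.nodup_cons.mp hl).2
    simp only [subOf, List.mem_append, List.mem_map, List.mem_cons]
    constructor
    · rintro (hZ | ⟨Z₀, hZ₀, rfl⟩) i hi
      · exact Or.inr ((ih hl').mp hZ i hi)
      · rw [Nat.testBit_lor] at hi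
        cases h0 : Z₀.testBit i
        · rw [h0, Bool.false_or] at hi
          by_cases hib : i = b
          · exact Or.inl hib
          · rw [Nat.testBit_two_pow_of_ne (Ne.symm hib)] at hi; exact absurd hi (by simp)
        · exact Or.inr ((ih hl').mp hZ₀ i h0)
    · intro hZ
      cases hb : Z.testBit b
      · left
        refine (ih hl').mpr (fun i hi => ?_)
        rcases hZ i hi with h1 | h1
        · subst h1; rw [hb] at hi; exact absurd hi (by simp)
        · exact h1
      · right
        refine ⟨Z ^^^ 2 ^ b, (ih hl').mpr (fun i hi => ?_), ?_⟩
        · rw [Nat.testBit_xor] at hi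
          by_cases hib : i = b
          · subst hib; rw [hb, Nat.testBit_two_pow_self] at hi; exact absurd hi (by simp)
          · rw [Nat.testBit_two_pow_of_ne (Ne.symm hib)] at hi
            rcases hZ i (by cases h0 : Z.testBit i <;> simp_all) with h1 | h1
            · exact absurd h1 hib
            · exact h1
        · refine Nat.eq_of_testBit_eq (fun i => ?_)
          rw [Nat.testBit_lor, Nat.testBit_xor]
          by_cases hib : i = b
          · subst hib; rw [hb, Nat.testBit_two_pow_self]; simp
          · rw [Nat.testBit_two_pow_of_ne (Ne.symm hib)]; simp

/-- All submasks of `M` (for `M < 2^h`). -/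
def submasks (h M : ℕ) : List ℕ := subOf (bitsList h M)

/-- Membership in `submasks`: exactly the bitmasks whose bits are bits of `M`. -/
theorem mem_submasks {M Z : ℕ} (hM : M < 2 ^ h) : Z ∈ submasks h M ↔ ∀ i, Z.testBit i = true → M.testBit i = true := by
  rw [submasks, mem_subOf (bitsList_nodup M)]
  constructor
  · intro hZ i hi; exact (mem_bitsList.mp (hZ i hi)).2
  · intro hZ i hi
    refine mem_bitsList.mpr ⟨?_, hZ i hi⟩
    by_contra hge
    have : M.testBit i = false := Nat.testBit_eq_false_of_lt (lt_of_lt_of_le hM (Nat.pow_le_pow_right (by norm_num) (not_lt.mp hge)))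
    rw [hZ i hi] at this; exact absurd this (by simp)

/-- A submask of a number below `2^h` is below `2^h`. -/
theorem lt_two_pow_of_bits {M Z : ℕ} (hM : M < 2 ^ h) (hZ : ∀ i, Z.testBit i = true → M.testBit i = true) : Z < 2 ^ h := by
  by_contra hge
  obtain ⟨i, hi, hiZ⟩ := Nat.exists_ge_and_testBit_of_ge_two_pow (not_lt.mp hge)
  have := hZ i hiZ
  rw [Nat.testBit_eq_false_of_lt (lt_of_lt_of_le hM (Nat.pow_le_pow_right (by norm_num) hi))] at this
  exact absurd this (by simp)

/-- The xor of a number below `2^h` with a submask of it is below `2^h` and has the expected bits. -/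
theorem testBit_xor_of_sub {U S : ℕ} (hS : ∀ i, S.testBit i = true → U.testBit i = true) (i : ℕ) :
    (U ^^^ S).testBit i = (U.testBit i && !S.testBit i) := by
  rw [Nat.testBit_xor]
  cases hU : U.testBit i <;> cases hSi : S.testBit i <;> simp_all

/-! ## 3. The decision procedure for door supports and its soundness -/

/-- **Door-support decision procedure** on bitmask data: roots `B γ`, tails `T γ b` (bitmasks indexed by naturals), column = a list of vertices, row = a
bitmask `U`. Peels the first vertex: choose a root bit `b` of `B γ` inside `U`, a submask `Z` of `T γ b` inside `U ∖ b`, and recurse on `U ∖ (b ∪ Z)`. -/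
def suppDec (B : ℕ → ℕ) (T : ℕ → ℕ → ℕ) : List (Fin h) → ℕ → Bool
  | [], U => U == 0
  | γ :: L, U => (bitsList h (B γ.val &&& U)).any fun b =>
      (submasks h (T γ.val b &&& (U ^^^ 2 ^ b))).any fun Z => suppDec B T L ((U ^^^ 2 ^ b) ^^^ Z)

/-- The finset-valued root data of bitmask root tables. -/
def rootsOf (B : ℕ → ℕ) : Fin h → Finset (Fin h) := fun γ => ofBits h (B γ.val)

/-- The finset-valued tail data of bitmask tail tables. -/
def tailsOf (T : ℕ → ℕ → ℕ) : Fin h → Fin h → Finset (Fin h) := fun γ b => ofBits h (T γ.val b.val)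

/-- Encoding a finset of `Fin h` as a bitmask (inverse to `ofBits`, used in the completeness direction). -/
def toBits (S : Finset (Fin h)) : ℕ := (List.finRange h).foldr (fun i acc => if i ∈ S then acc ||| 2 ^ i.val else acc) 0

/-- Bits of a `foldr`-encoded list. -/
private theorem testBit_foldr (S : Finset (Fin h)) (l : List (Fin h)) (j : ℕ) :
    (l.foldr (fun i acc => if i ∈ S then acc ||| 2 ^ i.val else acc) 0).testBit j = true ↔ ∃ i ∈ l, i.val = j ∧ i ∈ S := by
  induction l with
  | nil => simp
  | cons a l ih =>
    rw [List.foldr_cons]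
    by_cases ha : a ∈ S
    · rw [if_pos ha, Nat.testBit_lor, Bool.or_eq_true, ih]
      constructor
      · rintro (⟨i, hil, hij, hiS⟩ | hbit)
        · exact ⟨i, List.mem_cons_of_mem a hil, hij, hiS⟩
        · have haj : a.val = j := by
            by_contra hne; rw [Nat.testBit_two_pow_of_ne hne] at hbit; exact absurd hbit (by simp)
          exact ⟨a, List.mem_cons_self, haj, ha⟩
      · rintro ⟨i, hil, hij, hiS⟩
        rcases List.mem_cons.mp hil with rfl | hil'
        · right; rw [← hij, Nat.testBit_two_pow_self]
        · left; exact ⟨i, hil', hij, hiS⟩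
    · rw [if_neg ha, ih]
      constructor
      · rintro ⟨i, hil, hij, hiS⟩; exact ⟨i, List.mem_cons_of_mem a hil, hij, hiS⟩
      · rintro ⟨i, hil, hij, hiS⟩
        rcases List.mem_cons.mp hil with rfl | hil'
        · exact absurd hiS ha
        · exact ⟨i, hil', hij, hiS⟩

/-- Bits of `toBits S`: bit `j` is set iff `j < h` and `⟨j, _⟩ ∈ S`. -/
theorem testBit_toBits (S : Finset (Fin h)) (j : ℕ) : (toBits S).testBit j = true ↔ ∃ hj : j < h, (⟨j, hj⟩ : Fin h) ∈ S := by
  rw [toBits, testBit_foldr]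
  constructor
  · rintro ⟨i, _, hij, hiS⟩; subst hij; exact ⟨i.isLt, hiS⟩
  · rintro ⟨hj, hS⟩; exact ⟨⟨j, hj⟩, List.mem_finRange _, rfl, hS⟩

/-- `ofBits (toBits S) = S`. -/
theorem ofBits_toBits (S : Finset (Fin h)) : ofBits h (toBits S) = S := by
  ext b
  rw [mem_ofBits, testBit_toBits]
  constructor
  · rintro ⟨_, hb'⟩; exact hb'
  · intro hb'; exact ⟨b.isLt, hb'⟩

/-- `toBits S < 2^h`. -/
theorem toBits_lt (S : Finset (Fin h)) : toBits S < 2 ^ h := by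
  by_contra hge
  obtain ⟨i, hi, hiZ⟩ := Nat.exists_ge_and_testBit_of_ge_two_pow (not_lt.mp hge)
  obtain ⟨hj, _⟩ := (testBit_toBits S i).mp hiZ
  omega

/-- **Soundness and completeness of `suppDec`**: on a duplicate-free vertex list and a row bitmask below `2^h` it decides `DoorSupp` for the decoded data. -/
theorem suppDec_iff (B : ℕ → ℕ) (T : ℕ → ℕ → ℕ) :
    ∀ (L : List (Fin h)), L.Nodup → ∀ (U : ℕ), U < 2 ^ h →
      (suppDec B T L U = true ↔ DoorSupp (rootsOf B) (tailsOf T) L.toFinset (ofBits h U)) := by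
  classical
  intro L
  induction L with
  | nil =>
    intro _ U hU
    rw [suppDec, List.toFinset_nil, doorSupp_empty, beq_iff_eq, ofBits_eq_empty_iff hU]
  | cons γ L ih =>
    intro hnd U hU
    have hγL : γ ∉ L.toFinset := fun hmem => (List.nodup_cons.mp hnd).1 (List.mem_toFinset.mp hmem)
    rw [List.toFinset_cons, doorSupp_insert _ _ hγL, suppDec, List.any_eq_true]
    constructor
    · -- soundness: a successful run gives a decomposition
      rintro ⟨b, hb, hany⟩
      obtain ⟨hbh, hbBU⟩ := mem_bitsList.mp hb
      rw [Nat.testBit_land, Bool.and_eq_true] at hbBU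
      obtain ⟨hbB, hbU⟩ := hbBU
      obtain ⟨Z, hZ, hrec⟩ := List.any_eq_true.mp hany
      set U' := U ^^^ 2 ^ b with hU'
      have hsubb : ∀ i, (2 ^ b).testBit i = true → U.testBit i = true := by
        intro i hi
        by_cases hib : b = i
        · subst hib; exact hbU
        · rw [Nat.testBit_two_pow_of_ne hib] at hi; exact absurd hi (by simp)
      have hU'bits : ∀ i, U'.testBit i = (U.testBit i && !(2 ^ b).testBit i) := testBit_xor_of_sub hsubb
      have hU'lt : U' < 2 ^ h := lt_two_pow_of_bits hU (fun i hi => by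
        rw [hU'bits, Bool.and_eq_true] at hi; exact hi.1)
      have hM : T γ.val b &&& U' < 2 ^ h := lt_two_pow_of_bits hU'lt (fun i hi => by
        rw [Nat.testBit_land, Bool.and_eq_true] at hi; exact hi.2)
      have hZbits := (mem_submasks hM).mp hZ
      have hZU' : ∀ i, Z.testBit i = true → U'.testBit i = true := fun i hi => by
        have := hZbits i hi; rw [Nat.testBit_land, Bool.and_eq_true] at this; exact this.2
      have hZT : ∀ i, Z.testBit i = true → (T γ.val b).testBit i = true := fun i hi => by
        have := hZbits i hi; rw [Nat.testBit_land, Bool.and_eq_true] at this; exact this.1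
      have hU''bits : ∀ i, (U' ^^^ Z).testBit i = (U'.testBit i && !Z.testBit i) := testBit_xor_of_sub hZU'
      have hU''lt : U' ^^^ Z < 2 ^ h := lt_two_pow_of_bits hU'lt (fun i hi => by rw [hU''bits, Bool.and_eq_true] at hi; exact hi.1)
      have hrec' := (ih (List.nodup_cons.mp hnd).2 _ hU''lt).mp hrec
      refine ⟨⟨b, hbh⟩, mem_ofBits.mpr hbB, ofBits h Z, ?_, ?_, ?_, ?_⟩
      · rw [Finset.mem_powerset]
        intro x hx
        rw [Finset.mem_sdiff, Finset.mem_singleton]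
        refine ⟨Finset.mem_univ x, fun hxb => ?_⟩
        have hxZ := mem_ofBits.mp hx
        rw [hxb] at hxZ
        have := hZU' b hxZ
        rw [hU'bits, hbU, Nat.testBit_two_pow_self] at this
        exact absurd this (by simp)
      · intro x hx; exact mem_ofBits.mpr (hZT x.val (mem_ofBits.mp hx))
      · intro x hx
        rcases Finset.mem_insert.mp hx with rfl | hxZ
        · exact mem_ofBits.mpr hbU
        · have := hZU' x.val (mem_ofBits.mp hxZ)
          rw [hU'bits, Bool.and_eq_true] at this
          exact mem_ofBits.mpr this.1
      · have hset : ofBits h U \ insert (⟨b, hbh⟩ : Fin h) (ofBits h Z) = ofBits h (U' ^^^ Z) := by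
          ext x
          rw [Finset.mem_sdiff, Finset.mem_insert, mem_ofBits, mem_ofBits, mem_ofBits, hU''bits, hU'bits]
          constructor
          · rintro ⟨hxU, hno⟩
            have hxb : x.val ≠ b := fun heq => hno (Or.inl (Fin.ext heq))
            have hxZ : Z.testBit x.val ≠ true := fun hz => hno (Or.inr hz)
            rw [hxU, Nat.testBit_two_pow_of_ne (Ne.symm hxb)]
            cases hz : Z.testBit x.val
            · rfl
            · exact absurd hz hxZ
          · intro hx
            rw [Bool.and_eq_true, Bool.and_eq_true] at hx
            obtain ⟨⟨hxU, hnb⟩, hnZ⟩ := hx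
            refine ⟨hxU, fun hor => ?_⟩
            rcases hor with hxb | hxZ
            · rw [hxb, Nat.testBit_two_pow_self] at hnb; exact absurd hnb (by simp)
            · rw [hxZ] at hnZ; exact absurd hnZ (by simp)
        rw [hset]; exact hrec'
    · -- completeness: a decomposition is found by the run
      rintro ⟨b', hb'B, Z', hZ'pow, hZ'T, hins, hrest⟩
      have hb'U : U.testBit b'.val = true := mem_ofBits.mp (hins (Finset.mem_insert_self _ _))
      have hbZ' : b' ∉ Z' := fun hmem => by
        have := Finset.mem_powerset.mp hZ'pow hmem
        rw [Finset.mem_sdiff, Finset.mem_singleton] at this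
        exact this.2 rfl
      refine ⟨b'.val, mem_bitsList.mpr ⟨b'.isLt, by rw [Nat.testBit_land, mem_ofBits.mp hb'B, hb'U]; rfl⟩, ?_⟩
      rw [List.any_eq_true]
      set U' := U ^^^ 2 ^ b'.val with hU'
      have hsubb : ∀ i, (2 ^ b'.val).testBit i = true → U.testBit i = true := by
        intro i hi
        by_cases hib : b'.val = i
        · rw [← hib]; exact hb'U
        · rw [Nat.testBit_two_pow_of_ne hib] at hi; exact absurd hi (by simp)
      have hU'bits : ∀ i, U'.testBit i = (U.testBit i && !(2 ^ b'.val).testBit i) := testBit_xor_of_sub hsubb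
      have hU'lt : U' < 2 ^ h := lt_two_pow_of_bits hU (fun i hi => by rw [hU'bits, Bool.and_eq_true] at hi; exact hi.1)
      have hM : T γ.val b'.val &&& U' < 2 ^ h := lt_two_pow_of_bits hU'lt (fun i hi => by
        rw [Nat.testBit_land, Bool.and_eq_true] at hi; exact hi.2)
      set Z := toBits Z' with hZdef
      have hZbit : ∀ i, Z.testBit i = true ↔ ∃ hi : i < h, (⟨i, hi⟩ : Fin h) ∈ Z' := fun i => testBit_toBits Z' i
      have hZU' : ∀ i, Z.testBit i = true → U'.testBit i = true := by
        intro i hi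
        obtain ⟨hih, hiZ'⟩ := (hZbit i).mp hi
        have hiU : U.testBit i = true := mem_ofBits.mp (hins (Finset.mem_insert_of_mem hiZ'))
        have hib : b'.val ≠ i := fun heq => hbZ' (by rw [show b' = ⟨i, hih⟩ from Fin.ext heq]; exact hiZ')
        rw [hU'bits, hiU, Nat.testBit_two_pow_of_ne hib]; rfl
      refine ⟨Z, (mem_submasks hM).mpr (fun i hi => ?_), ?_⟩
      · obtain ⟨hih, hiZ'⟩ := (hZbit i).mp hi
        rw [Nat.testBit_land, hZU' i hi, mem_ofBits.mp (hZ'T hiZ')]; rfl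
      · have hU''bits : ∀ i, (U' ^^^ Z).testBit i = (U'.testBit i && !Z.testBit i) := testBit_xor_of_sub hZU'
        have hU''lt : U' ^^^ Z < 2 ^ h := lt_two_pow_of_bits hU'lt (fun i hi => by rw [hU''bits, Bool.and_eq_true] at hi; exact hi.1)
        refine (ih (List.nodup_cons.mp hnd).2 _ hU''lt).mpr ?_
        have hset : ofBits h (U' ^^^ Z) = ofBits h U \ insert b' Z' := by
          ext x
          rw [Finset.mem_sdiff, Finset.mem_insert, mem_ofBits, mem_ofBits, hU''bits, hU'bits, Bool.and_eq_true, Bool.and_eq_true]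
          constructor
          · rintro ⟨⟨hxU, hnb⟩, hnZ⟩
            refine ⟨hxU, fun hor => ?_⟩
            rcases hor with rfl | hxZ'
            · rw [Nat.testBit_two_pow_self] at hnb; exact absurd hnb (by simp)
            · have : Z.testBit x.val = true := (hZbit x.val).mpr ⟨x.isLt, hxZ'⟩
              rw [this] at hnZ; exact absurd hnZ (by simp)
          · rintro ⟨hxU, hno⟩
            have hxb : b'.val ≠ x.val := fun heq => hno (Or.inl (Fin.ext heq).symm)
            refine ⟨⟨hxU, by rw [Nat.testBit_two_pow_of_ne hxb]; rfl⟩, ?_⟩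
            cases hz : Z.testBit x.val
            · rfl
            · exact absurd ((hZbit x.val).mp hz).2 (fun hxZ' => hno (Or.inr hxZ'))
        rw [hset]; exact hrest

/-! ## 4. LT certificates from checkable data -/

/-- **`LTCert` from bitmask data and `decide`-able checks.** Rows and columns are given as bitmask tables (`rows i`, `cols j < 2^h`), the support data as
bitmask tables `B`, `T`, the row/column orders as mutually inverse index tables; the diagonal entries must pass `suppDec` and the entries below the diagonal fail it. -/
theorem ltCert_of_suppDec {r : ℕ} (rows cols : Fin r → ℕ) (hrows : ∀ i, rows i < 2 ^ h) (B : ℕ → ℕ) (T : ℕ → ℕ → ℕ)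
    (σR σRi σC σCi : Fin r → Fin r) (hR1 : ∀ i, σRi (σR i) = i) (hR2 : ∀ i, σR (σRi i) = i)
    (hC1 : ∀ i, σCi (σC i) = i) (hC2 : ∀ i, σC (σCi i) = i)
    (hdiag : ∀ i, suppDec B T (bitsFinList h (cols (σC i))) (rows (σR i)) = true)
    (htri : ∀ i j : Fin r, j < i → suppDec B T (bitsFinList h (cols (σC j))) (rows (σR i)) = false) :
    LTCert (fun i => ofBits h (rows i)) (fun j => ofBits h (cols j)) := by
  refine ⟨rootsOf B, tailsOf T, ⟨σR, σRi, hR1, hR2⟩, ⟨σC, σCi, hC1, hC2⟩, fun i => ?_, fun i j hij hsupp => ?_⟩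
  · have := (suppDec_iff B T _ (bitsFinList_nodup _) _ (hrows (σR i))).mp (hdiag i)
    rw [toFinset_bitsFinList] at this
    exact this
  · have key := htri i j hij
    have hs : suppDec B T (bitsFinList h (cols (σC j))) (rows (σR i)) = true := by
      refine (suppDec_iff B T _ (bitsFinList_nodup _) _ (hrows (σR i))).mpr ?_
      rw [toFinset_bitsFinList]
      exact hsupp
    rw [hs] at key
    exact absurd key (by simp)

end Bits

end Summit.ValiantsHypothesis.ValiantsHypothesis.Theorems.BarrierLever.AnchoredPeeling
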